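import Summits.CriticalPhenomena.CardyFormulaZ2.Theorems.CardyBoundaryCoulombGasBoundaryDefectGaussianRS18Rainbow22Part4
import Summits.CriticalPhenomena.CardyFormulaZ2.Theorems.CardyBoundaryCoulombGasBoundaryDefectGaussianRStubDictionaryPositivity
import Summits.CriticalPhenomena.CardyFormulaZ2.Theorems.CardyBoundaryCoulombGasBoundaryDefectGaussianRStubReferenceLimitPart6
import Mathlib.Analysis.SpecificLimits.Basic
import HarnessLib

/-!
# Hardness certificate of crux `BoundaryDefectGaussianR` (stmt-CriticalPhenomena-14132), line
# `rainbow-monomials-in-excursion-kernels` — Stub H2: on the lattice squares, the `(2;2)` rainbow ratio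
# is a two-point connection probability

On the lattice squares `V_n = [-12(n+1), 12(n+1)]²` (the lattice approximations of the closed reference
square `[-1, 1]²` at mesh `δ_n = 1/(12(n+1))`) with the `(2;2)` datum (`k = 2`, `L = ![2, 2]`, sink
`j = 1`) at the bottom-row points `p_n 0 = (-4(n+1), -12(n+1))` (source) and `p_n 1 = (4(n+1), -12(n+1))`
(sink), eventually

  `‖Zins (V_n) ι‖ / ‖Z (ofDomain V_n)‖ = P_{1/2}[p_n 0 ↔ p_n 1 inside the box]`

(`h19_boxRatio_eq_conn`, registered). This is the insertion dictionary `r22_ratio_eq`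
(…S18Rainbow22Part4) re-run with per-point flatness: the eventual regularity package
`s17_eventually_regular` and the eventual existence of configurations `s17_eventually_configsNonempty`
(…StubDictionaryPositivity) applied to the reference square `rectDomain 1 1` with `r = 1/3`
(`r/δ_n = 4(n+1)`: the disc of that radius about either point sees the box as the upper half-plane of
the bottom row), admissibility on the box `isAdmissible_of_box` (…StubReferenceLimitPart3), then
`s17_dictionary` (`‖Zins‖ = #Rainbow`), `norm_Z_ofDomain` (`‖Z‖ = 2^{|E|}`), `s18_rainbow22_iff_conn`
(`Rainbow ↔ {p 0 ↔ p 1 in V}`) and `r22_prob_eq_card`; finally the site image of the box is the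
set-builder box of `Site 2`. All [folklore] glue over landed theorems; no new objects.
-/

noncomputable section

namespace Summit.CriticalPhenomena.CardyFormulaZ2.Cruxes.BoundaryDefectGaussianR.RainbowMonomialsInExcursionKernels

open Filter Topology MeasureTheory
open Literature.Probability.RandomPlanarGeometry Literature.Probability.LatticeModels
  Literature.Probability.LatticeModels.CollarLegModel Literature.Probability.Percolation

/-! ### Arithmetic of the meshes `δ_n = 1/(12(n+1))` and the lattice squares -/

/-- `1/δ_n = 12(n+1)`. [folklore] -/
theorem boxr_one_div {δ : ℝ} {n : ℕ} (hδ : δ = 1 / (12 * ((n : ℝ) + 1))) : 1 / δ = 12 * ((n : ℝ) + 1) := by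
  rw [hδ, one_div_one_div]

/-- `(1/3)/δ_n = 4(n+1)`, as the cast of an integer. [folklore] -/
theorem boxr_third_div {δ : ℝ} {n : ℕ} (hδ : δ = 1 / (12 * ((n : ℝ) + 1))) :
    (1 / 3) / δ = ((4 * ((n : ℤ) + 1) : ℤ) : ℝ) := by
  rw [hδ, div_div_eq_mul_div, div_one]
  push_cast
  ring

/-- `⌊1/δ_n⌋₊ = 12(n+1)`. [folklore] -/
theorem boxr_natFloor {δ : ℝ} {n : ℕ} (hδ : δ = 1 / (12 * ((n : ℝ) + 1))) :
    ((⌊1 / δ⌋₊ : ℕ) : ℤ) = 12 * ((n : ℤ) + 1) := by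
  have h : 1 / δ = ((12 * (n + 1) : ℕ) : ℝ) := by rw [boxr_one_div hδ]; push_cast; ring
  rw [h, Nat.floor_natCast]
  push_cast
  ring

/-- **The lattice squares are the boxes `[-12(n+1), 12(n+1)]²`** (`square_latticeBox` with
`⌊1/δ_n⌋₊ = 12(n+1)`). [folklore] -/
theorem boxr_box {δ : ℝ} {n : ℕ} (hδ : δ = 1 / (12 * ((n : ℝ) + 1))) {V : Finset (ℤ × ℤ)}
    (hV : ∀ v : ℤ × ℤ, v ∈ V ↔
      ((v.1 : ℂ) * ((δ : ℝ) : ℂ) + (v.2 : ℂ) * ((δ : ℝ) : ℂ) * Complex.I) ∈ closure (symRect 1 1)) :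
    ∀ v : ℤ × ℤ, v ∈ V ↔ (-(12 * ((n : ℤ) + 1)) ≤ v.1 ∧ v.1 ≤ 12 * ((n : ℤ) + 1)) ∧
      (-(12 * ((n : ℤ) + 1)) ≤ v.2 ∧ v.2 ≤ 12 * ((n : ℤ) + 1)) := by
  have hδpos : 0 < δ := by rw [hδ]; positivity
  intro v
  rw [square_latticeBox hδpos hV v, boxr_natFloor hδ]

/-- **Flatness of the box at a bottom-row point off the corners**: within distance `4N` of a point
`z = (±4N, -12N)` of the bottom row of the box `[-12N, 12N]²`, the box is the upper half-plane of the
row (inward normal `(0, 1)`). [folklore] -/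
theorem boxr_flat {V : Finset (ℤ × ℤ)} {N : ℤ} (hN : 0 ≤ N)
    (hbox : ∀ v : ℤ × ℤ, v ∈ V ↔ (-(12 * N) ≤ v.1 ∧ v.1 ≤ 12 * N) ∧ (-(12 * N) ≤ v.2 ∧ v.2 ≤ 12 * N))
    {z : ℤ × ℤ} (hz1 : z.1 = -(4 * N) ∨ z.1 = 4 * N) (hz2 : z.2 = -(12 * N)) {v : ℤ × ℤ}
    (hv : (v.1 - z.1) ^ 2 + (v.2 - z.2) ^ 2 ≤ (4 * N) ^ 2) :
    v ∈ V ↔ 0 ≤ (v.1 - z.1) * 0 + (v.2 - z.2) * 1 := by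
  have h1 : (v.1 - z.1) ^ 2 ≤ (4 * N) ^ 2 := by nlinarith [sq_nonneg (v.2 - z.2)]
  have h2 : (v.2 - z.2) ^ 2 ≤ (4 * N) ^ 2 := by nlinarith [sq_nonneg (v.1 - z.1)]
  obtain ⟨h1a, h1b⟩ := abs_le_of_sq_le_sq' h1 (by linarith)
  obtain ⟨h2a, h2b⟩ := abs_le_of_sq_le_sq' h2 (by linarith)
  rw [hbox]
  omega

/-! ### The registered stub -/

/-- **Stub H2 (`h19_boxRatio_eq_conn`, registered on stmt-CriticalPhenomena-14132).** On the lattice squares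
`V_n = [-12(n+1), 12(n+1)]²` (mesh `δ_n = 1/(12(n+1))` of the reference square `(-1,1)²`) with the `(2;2)`
datum at the bottom-row points `(∓4(n+1), -12(n+1))`, eventually
`‖Zins‖/‖Z‖ = P_{1/2}[(-4(n+1), -12(n+1)) ↔ (4(n+1), -12(n+1)) in V_n]`: the insertion dictionary
`s17_dictionary` (`‖Zins‖ = #Rainbow`, configurations exist eventually by `s17_eventually_configsNonempty`,
regularity of the squares eventually by `s17_eventually_regular`, admissibility by `isAdmissible_of_box`),
the closed-collar dictionary `norm_Z_ofDomain` (`‖Z‖ = 2^{|E|}`), the identification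
`s18_rainbow22_iff_conn` (`Rainbow ↔ {p 0 ↔ p 1 in V}`) and the count `r22_prob_eq_card`.
[cite: BaxterKellandWu1976, §3–§4] -/
theorem h19_boxRatio_eq_conn : ∀ (δ : ℕ → ℝ) (V : ℕ → Finset (ℤ × ℤ)) (p : ℕ → Fin 2 → ℤ × ℤ),
    (∀ n, δ n = 1 / (12 * ((n : ℝ) + 1))) →
    (∀ n, ∀ v : ℤ × ℤ, v ∈ V n ↔ ((v.1 : ℂ) * ((δ n : ℝ) : ℂ) + (v.2 : ℂ) * ((δ n : ℝ) : ℂ) * Complex.I) ∈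
      closure (Literature.Probability.RandomPlanarGeometry.symRect 1 1)) →
    (∀ n, p n 0 = (-(4 * ((n : ℤ) + 1)), -(12 * ((n : ℤ) + 1)))) →
    (∀ n, p n 1 = (4 * ((n : ℤ) + 1), -(12 * ((n : ℤ) + 1)))) →
    ∀ᶠ n in Filter.atTop,
      ‖Literature.Probability.LatticeModels.CollarLegModel.Zins (V n)
          (⟨(Finset.univ.erase 1).image (p n), fun v ↦ ∑ i ∈ (Finset.univ.erase 1).filter (fun i ↦ p n i = v),
            (![2, 2] : Fin 2 → ℕ) i, p n 1⟩ : Literature.Probability.LatticeModels.CollarLegModel.LegInsertionData)‖ /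
        ‖(Literature.Probability.LatticeModels.CollarLegModel.ofDomain (V n)).Z‖ =
      (Literature.Probability.Percolation.bondPercolation (Literature.Probability.LatticeModels.zdGraph 2)
          Literature.Probability.Percolation.half).real
        (Literature.Probability.Percolation.openConnIn
          {v : Literature.Probability.LatticeModels.Site 2 |
            (-(12 * ((n : ℤ) + 1)) ≤ v 0 ∧ v 0 ≤ 12 * ((n : ℤ) + 1)) ∧
              (-(12 * ((n : ℤ) + 1)) ≤ v 1 ∧ v 1 ≤ 12 * ((n : ℤ) + 1))}
          (![-(4 * ((n : ℤ) + 1)), -(12 * ((n : ℤ) + 1))] : Literature.Probability.LatticeModels.Site 2)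
          (![4 * ((n : ℤ) + 1), -(12 * ((n : ℤ) + 1))] : Literature.Probability.LatticeModels.Site 2)) := by
  intro δ V p hδ hV hp0 hp1
  classical
  -- the mesh sequence
  have hδpos : ∀ n, 0 < δ n := fun n ↦ by rw [hδ]; positivity
  have hδ0 : Tendsto δ atTop (𝓝 0) := by
    have h := (tendsto_one_div_add_atTop_nhds_zero_nat (𝕜 := ℝ)).const_mul (1 / 12 : ℝ)
    rw [mul_zero] at h
    exact h.congr fun n ↦ by rw [hδ n, mul_one_div, div_div]
  -- the sink rule of the `(2;2)` family and the rectilinear reference square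
  have hL : (![2, 2] : Fin 2 → ℕ) 1 = ∑ i ∈ Finset.univ.erase 1, (![2, 2] : Fin 2 → ℕ) i := by
    rw [r22_univ_erase_one, Finset.sum_singleton]; rfl
  have hD : ∃ S : Finset (ℂ × ℂ), (∀ q ∈ S, q.1.re = q.2.re ∨ q.1.im = q.2.im) ∧
      frontier (rectDomain 1 1 one_pos one_pos).carrier ⊆ ⋃ q ∈ S, segment ℝ q.1 q.2 :=
    ⟨_, square_sides_axisParallel, frontier_square_subset⟩
  have hr : (0 : ℝ) < 1 / 3 := by norm_num
  -- eventual regularity of the squares and eventual existence of configurations (radius `r/δ_n = 4(n+1)`)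
  have hreg := s17_eventually_regular 2 ![2, 2] 1 hL (rectDomain 1 1 one_pos one_pos) hD (1 / 3) hr δ
    hδpos hδ0 V hV
  have hcfg := s17_eventually_configsNonempty 2 ![2, 2] 1 hL (rectDomain 1 1 one_pos one_pos) hD (1 / 3)
    hr δ hδpos hδ0 V hV
  filter_upwards [hreg, hcfg] with n hregn hcfgn
  -- the box, the two points, the radius
  have hN : (0 : ℤ) ≤ (n : ℤ) + 1 := by positivity
  have hbox := boxr_box (hδ n) (hV n)
  have hrad : (1 / 3) / δ n = ((4 * ((n : ℤ) + 1) : ℤ) : ℝ) := boxr_third_div (hδ n)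
  have hpx : ∀ i, ((p n i).1 = -(4 * ((n : ℤ) + 1)) ∨ (p n i).1 = 4 * ((n : ℤ) + 1)) ∧
      (p n i).2 = -(12 * ((n : ℤ) + 1)) :=
    Fin.forall_fin_two.2 ⟨by rw [hp0]; exact ⟨Or.inl rfl, rfl⟩, by rw [hp1]; exact ⟨Or.inr rfl, rfl⟩⟩
  have h01 : p n 0 ≠ p n 1 := by
    rw [hp0, hp1, ne_eq, Prod.mk.injEq]
    omega
  have hinj : Function.Injective (p n) := by
    intro a b h
    by_contra hab
    have key : ∀ a b : Fin 2, a ≠ b → p n a ≠ p n b :=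
      Fin.forall_fin_two.2 ⟨Fin.forall_fin_two.2 ⟨fun h' ↦ absurd rfl h', fun _ ↦ h01⟩,
        Fin.forall_fin_two.2 ⟨fun _ ↦ h01.symm, fun h' ↦ absurd rfl h'⟩⟩
    exact key a b hab h
  -- the `(2;2)` datum
  set ι : LegInsertionData := ⟨(Finset.univ.erase 1).image (p n),
    fun v ↦ ∑ b ∈ (Finset.univ.erase 1).filter (fun b ↦ p n b = v), (![2, 2] : Fin 2 → ℕ) b, p n 1⟩
  obtain ⟨hsrc, hlegs, hsink⟩ : ι.source = {p n 0} ∧ ι.legs (p n 0) = 2 ∧ ι.sink = p n 1 := r22_datum (p n)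
  have hSL : ι.sinkLegs = 2 := r22_sinkLegs ι hsrc hlegs
  have hins : ∀ z ∈ insert ι.sink ι.source, z = p n 1 ∨ z = p n 0 := by
    intro z hz; rw [hsrc, hsink, Finset.mem_insert, Finset.mem_singleton] at hz; exact hz
  have hinsx : ∀ z ∈ insert ι.sink ι.source, (z.1 = -(4 * ((n : ℤ) + 1)) ∨ z.1 = 4 * ((n : ℤ) + 1)) ∧
      z.2 = -(12 * ((n : ℤ) + 1)) := by
    intro z hz
    rcases hins z hz with rfl | rfl
    · exact hpx 1
    · exact hpx 0
  -- admissibility on the box `[-12(n+1), -12(n+1) + 24(n+1)]²`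
  have hadm : ι.IsAdmissible (V n) := by
    have hbox' : ∀ v : ℤ × ℤ, v ∈ V n ↔
        (-(12 * ((n : ℤ) + 1)) ≤ v.1 ∧ v.1 ≤ -(12 * ((n : ℤ) + 1)) + ((24 * (n + 1) : ℕ) : ℤ)) ∧
        (-(12 * ((n : ℤ) + 1)) ≤ v.2 ∧ v.2 ≤ -(12 * ((n : ℤ) + 1)) + ((24 * (n + 1) : ℕ) : ℤ)) := by
      intro v; rw [hbox v]; omega
    refine isAdmissible_of_box hbox' (by positivity) ι (G := 2) ?_ ?_ ?_ hSL.le ?_ ?_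
    · rw [hsrc]; exact Finset.singleton_nonempty _
    · intro x hx
      rw [hsrc, Finset.mem_singleton] at hx
      rw [hx, hlegs]
      norm_num
    · rw [hsrc, hsink, Finset.mem_singleton]; exact fun h ↦ h01 h.symm
    · intro x hx
      obtain ⟨h1, h2⟩ := hinsx x hx
      exact ⟨h2, by omega, by omega⟩
    · intro x hx x' hx' hne
      obtain ⟨h1, h2⟩ := hinsx x hx
      obtain ⟨h1', h2'⟩ := hinsx x' hx'
      have hne1 : x.1 ≠ x'.1 := fun h ↦ hne (Prod.ext h (h2.trans h2'.symm))
      rw [le_abs]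
      omega
  -- flatness at radius `4(n+1)` about each point, and separation
  have hflat : ∀ i', ∃ d : ℤ × ℤ, (d = (1, 0) ∨ d = (-1, 0) ∨ d = (0, 1) ∨ d = (0, -1)) ∧
      ∀ v : ℤ × ℤ, ((((v.1 - (p n i').1) ^ 2 + (v.2 - (p n i').2) ^ 2 : ℤ) : ℝ)) ≤ ((1 / 3) / δ n) ^ 2 →
        (v ∈ V n ↔ 0 ≤ (v.1 - (p n i').1) * d.1 + (v.2 - (p n i').2) * d.2) := by
    intro i'
    refine ⟨(0, 1), Or.inr (Or.inr (Or.inl rfl)), fun v hv ↦ ?_⟩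
    rw [hrad, ← Int.cast_pow, Int.cast_le] at hv
    exact boxr_flat hN hbox (hpx i').1 (hpx i').2 hv
  have hsep : ∀ i₁ i₂ : Fin 2, i₁ ≠ i₂ → ((1 / 3) / δ n) ^ 2 ≤
      (((((p n i₁).1 - (p n i₂).1) ^ 2 + ((p n i₁).2 - (p n i₂).2) ^ 2 : ℤ) : ℝ)) := by
    intro i₁ i₂ hne
    rw [hrad, ← Int.cast_pow, Int.cast_le]
    obtain ⟨h1, h2⟩ := hpx i₁
    obtain ⟨h1', h2'⟩ := hpx i₂
    have hne1 : (p n i₁).1 ≠ (p n i₂).1 := fun h ↦ hne (hinj (Prod.ext h (h2.trans h2'.symm)))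
    have hd : (p n i₁).1 - (p n i₂).1 = 8 * ((n : ℤ) + 1) ∨ (p n i₁).1 - (p n i₂).1 = -(8 * ((n : ℤ) + 1)) := by
      omega
    have h22 : (p n i₁).2 - (p n i₂).2 = 0 := by omega
    rw [h22]
    rcases hd with hd | hd <;> rw [hd] <;> nlinarith [sq_nonneg ((n : ℤ) + 1)]
  -- the regularity package and a configuration, at this `n`
  obtain ⟨hFL4, hCH, hconn, hK, hKC⟩ := hregn (p n) hinj hadm hflat hsep
  have hne := hcfgn (p n) hinj hadm hflat hsep
  -- flatness at radius `sinkLegs + 3` from radius `sinkLegs + 4`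
  have hflat3 : ∀ z ∈ insert ι.sink ι.source, ∃ dvec : ℤ × ℤ,
      (dvec = (1, 0) ∨ dvec = (-1, 0) ∨ dvec = (0, 1) ∨ dvec = (0, -1)) ∧
      ∀ v : ℤ × ℤ, (v.1 - z.1) ^ 2 + (v.2 - z.2) ^ 2 ≤ ((ι.sinkLegs : ℤ) + 3) ^ 2 →
        (v ∈ V n ↔ 0 ≤ (v.1 - z.1) * dvec.1 + (v.2 - z.2) * dvec.2) := by
    intro z hz
    obtain ⟨dvec, hd, h⟩ := hFL4 z hz
    have h34 : ((ι.sinkLegs : ℤ) + 3) ^ 2 ≤ ((ι.sinkLegs : ℤ) + 4) ^ 2 := by rw [hSL]; norm_num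
    exact ⟨dvec, hd, fun v hv ↦ h v (hv.trans h34)⟩
  -- dictionary, closed collar, identification, count
  have hdict := s17_dictionary ι (V n) hadm hFL4 hCH hconn hK hKC hne
  have hZ := norm_Z_ofDomain hK
  have hA := s18_rainbow22_iff_conn ι (V n) (p n 0) hsrc hlegs hadm hflat3 hCH
  have hcount := r22_prob_eq_card (V n) (p n 0) (p n 1)
  have hfilter : (ι.model (V n)).E.powerset.filter (fun ω => ι.Rainbow (V n) ω) =
      (inducedEdges (V n)).powerset.filter (fun ω => (↑(ω.image edgeSym2) : Set (Sym2 (Site 2))) ∈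
        openConnIn (↑((V n).image toSite) : Set (Site 2)) (toSite (p n 0)) (toSite (p n 1))) := by
    refine Finset.filter_congr fun ω hω => ?_
    rw [hA ω (Finset.mem_powerset.1 hω), hsink]
    rfl
  have key : ‖Zins (V n) ι‖ / ‖(ofDomain (V n)).Z‖ = (bondPercolation (zdGraph 2) half).real
      (openConnIn (↑((V n).image toSite) : Set (Site 2)) (toSite (p n 0)) (toSite (p n 1))) := by
    rw [hdict, hZ, hfilter]
    exact hcount.symm
  -- the site image of the box is the set-builder box; the two points
  have hS : (↑((V n).image toSite) : Set (Site 2)) =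
      {v : Site 2 | (-(12 * ((n : ℤ) + 1)) ≤ v 0 ∧ v 0 ≤ 12 * ((n : ℤ) + 1)) ∧
        (-(12 * ((n : ℤ) + 1)) ≤ v 1 ∧ v 1 ≤ 12 * ((n : ℤ) + 1))} := by
    ext v
    rw [Finset.coe_image, Set.mem_image, Set.mem_setOf_eq]
    constructor
    · rintro ⟨w, hw, rfl⟩
      rw [Finset.mem_coe, hbox] at hw
      simpa [toSite] using hw
    · intro hv
      exact ⟨(v 0, v 1), by rw [Finset.mem_coe, hbox]; exact hv, by funext i; fin_cases i <;> rfl⟩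
  have ha : toSite (p n 0) = (![-(4 * ((n : ℤ) + 1)), -(12 * ((n : ℤ) + 1))] : Site 2) := by rw [hp0]; rfl
  have hb : toSite (p n 1) = (![4 * ((n : ℤ) + 1), -(12 * ((n : ℤ) + 1))] : Site 2) := by rw [hp1]; rfl
  rw [key, hS, ha, hb]

end Summit.CriticalPhenomena.CardyFormulaZ2.Cruxes.BoundaryDefectGaussianR.RainbowMonomialsInExcursionKernels

end
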